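import Mathlib
import Summits.NavierStokesRegularity.FunctionalMining.TopEigHeatCoercive

/-!
# SECANT-A — two-sided, eigenvector-free secant bounds for the static heat dissipation
(census-1 g22, `pub-nsfunc`, STAGING kernel shadow; METHODS (cc.41)).

search for candidate a priori estimates; no regularity claim.

The tree (`TopEigHeatCoercive.lean`, dict g13) defines the FIELD quantity
`heatDissipation Φ v := ⨆ t>0, (Φ v − Φ (v + t•Δv)) / t` and explains in prose (module docstring,
"WHY `heatDissipation` IS `D₀`") that for a functional convex along the line `t ↦ v + tΔv` the forward
difference quotients are non-increasing in `t` and bounded by any backward quotient. This file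
KERNEL-CHECKS exactly that bookkeeping and packages it as a certificate interface:

* `fwd_secant_antitone`, `fwd_secant_le_bwd_secant`, `bwd_secant_monotone` — secant calculus of a
  convex `g : ℝ → ℝ` at `0` (from `ConvexOn.secant_mono_aux1`);
* `iSup_fwd_secant_le_bwd_secant`, `fwd_secant_le_iSup` — the `⨆ t>0` of the forward quotients is
  sandwiched: `(g 0 − g t)/t ≤ ⨆ ≤ (g (−τ) − g 0)/τ` for ALL `t, τ > 0`;
* `fwd_secant_le_heatDissipation`, `heatDissipation_le_bwd_secant` — the same for the tree's
  `heatDissipation Φ v` under the hypothesis `ConvexOn ℝ univ (fun t ↦ Φ (v + t • Δv))`;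
* `HeatCoercive.rate_le_bwd_secant_quotient` — ONE field caps every admissible rate:
  `HeatCoercive Φ c → (d = 3, v smooth div-free zero-mean, Φ v > 0, Φ convex along the heat line) →
   c ≤ (Φ (v − τ•Δv) − Φ v) / (τ · Φ v)` for every `τ > 0` — no eigenvector, no derivative, no
  semigroup: two evaluations of `Φ` at explicit fields. This is the Lean-side reading of an
  UPPER-BOUND CERTIFICATE for `c_q = inf R_q` (census-1 L-LAM-CERT-A certified `inf R₂ ≤ 1.8997` by an
  interval Hellmann–Feynman sum; the secant form needs only certified enclosures of `Φ` itself).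

Convexity of `t ↦ ∫(λ₁⁺)^q (S_{v + tΔv})` (λ₁ convex on symmetric matrices, `r ↦ (r⁺)^q` convex
non-decreasing, `S` linear) is NOT proved here — it stays the hypothesis `hconv`, as in the tree's prose.
Nothing in this file is a regularity statement or moves a verdict. STAGING only: census-1 files nothing
under `Summits/`; filed by the prove seat (gen 11) verbatim up to the namespace
`Summit.NavierStokesRegularity.FunctionalMining.SecantA`.
-/

namespace Summit.NavierStokesRegularity.FunctionalMining.SecantA

open Set

section ConvexSecant

variable {g : ℝ → ℝ}

/-- Three-point form of convexity at `−τ < 0 < t`: `(t + τ) g 0 ≤ t g(−τ) + τ g t`. -/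
theorem three_point (hg : ConvexOn ℝ univ g) {t τ : ℝ} (ht : 0 < t) (hτ : 0 < τ) :
    (t + τ) * g 0 ≤ t * g (-τ) + τ * g t := by
  have h := hg.secant_mono_aux1 (x := -τ) (y := 0) (z := t) (mem_univ _) (mem_univ _)
    (by linarith) ht
  -- h : (t - -τ) * g 0 ≤ (t - 0) * g (-τ) + (0 - -τ) * g t
  have e1 : (t - -τ) = t + τ := by ring
  have e2 : (t - 0) = t := by ring
  have e3 : (0 - -τ) = τ := by ring
  rw [e1, e2, e3] at h
  exact h

/-- Every forward secant quotient at `0` is below every backward one. -/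
theorem fwd_secant_le_bwd_secant (hg : ConvexOn ℝ univ g) {t τ : ℝ} (ht : 0 < t) (hτ : 0 < τ) :
    (g 0 - g t) / t ≤ (g (-τ) - g 0) / τ := by
  rw [div_le_div_iff₀ ht hτ]
  have h := three_point hg ht hτ
  nlinarith [h]

/-- Forward secant quotients `(g 0 − g t)/t` are non-increasing in `t > 0`. -/
theorem fwd_secant_antitone (hg : ConvexOn ℝ univ g) {s t : ℝ} (hs : 0 < s) (hst : s ≤ t) :
    (g 0 - g t) / t ≤ (g 0 - g s) / s := by
  have ht : 0 < t := hs.trans_le hst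
  rcases eq_or_lt_of_le hst with rfl | hst'
  · exact le_rfl
  have h := hg.secant_mono_aux1 (x := 0) (y := s) (z := t) (mem_univ _) (mem_univ _) hs hst'
  -- h : (t - 0) * g s ≤ (t - s) * g 0 + (s - 0) * g t
  simp only [sub_zero] at h
  rw [div_le_div_iff₀ ht hs]
  nlinarith [h]

/-- Backward secant quotients `(g(−τ) − g 0)/τ` are non-decreasing in `τ > 0`
(so the sharpest upper bound is the limit `τ → 0⁺`). -/
theorem bwd_secant_monotone (hg : ConvexOn ℝ univ g) {σ τ : ℝ} (hσ : 0 < σ) (hστ : σ ≤ τ) :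
    (g (-σ) - g 0) / σ ≤ (g (-τ) - g 0) / τ := by
  have hτ : 0 < τ := hσ.trans_le hστ
  rcases eq_or_lt_of_le hστ with rfl | hστ'
  · exact le_rfl
  have h := hg.secant_mono_aux1 (x := -τ) (y := -σ) (z := 0) (mem_univ _) (mem_univ _)
    (by linarith) (by linarith)
  -- h : (0 - -τ) * g (-σ) ≤ (0 - -σ) * g (-τ) + (-σ - -τ) * g 0
  have e1 : (0 - -τ) = τ := by ring
  have e2 : (0 - -σ) = σ := by ring
  have e3 : (-σ - -τ) = τ - σ := by ring
  rw [e1, e2, e3] at h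
  rw [div_le_div_iff₀ hσ hτ]
  nlinarith [h]

/-- The forward secant quotients over `t > 0` are bounded above (by any backward quotient). -/
theorem bddAbove_fwd_secant (hg : ConvexOn ℝ univ g) :
    BddAbove (range fun t : {t : ℝ // 0 < t} => (g 0 - g (t : ℝ)) / (t : ℝ)) := by
  refine ⟨(g (-1) - g 0) / 1, ?_⟩
  rintro _ ⟨t, rfl⟩
  exact fwd_secant_le_bwd_secant hg t.2 one_pos

/-- Lower half of the sandwich: each forward quotient is below the supremum. -/
theorem fwd_secant_le_iSup (hg : ConvexOn ℝ univ g) {t : ℝ} (ht : 0 < t) :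
    (g 0 - g t) / t ≤ ⨆ s : {s : ℝ // 0 < s}, (g 0 - g (s : ℝ)) / (s : ℝ) :=
  le_ciSup (bddAbove_fwd_secant hg) ⟨t, ht⟩

/-- Upper half of the sandwich: the supremum of the forward quotients is below every backward quotient. -/
theorem iSup_fwd_secant_le_bwd_secant (hg : ConvexOn ℝ univ g) {τ : ℝ} (hτ : 0 < τ) :
    (⨆ s : {s : ℝ // 0 < s}, (g 0 - g (s : ℝ)) / (s : ℝ)) ≤ (g (-τ) - g 0) / τ := by
  haveI : Nonempty {s : ℝ // 0 < s} := ⟨⟨1, one_pos⟩⟩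
  exact ciSup_le fun s => fwd_secant_le_bwd_secant hg s.2 hτ

/-- The two-sided secant sandwich, for all `t, τ > 0`. -/
theorem secant_sandwich (hg : ConvexOn ℝ univ g) {t τ : ℝ} (ht : 0 < t) (hτ : 0 < τ) :
    (g 0 - g t) / t ≤ (⨆ s : {s : ℝ // 0 < s}, (g 0 - g (s : ℝ)) / (s : ℝ)) ∧
      (⨆ s : {s : ℝ // 0 < s}, (g 0 - g (s : ℝ)) / (s : ℝ)) ≤ (g (-τ) - g 0) / τ :=
  ⟨fwd_secant_le_iSup hg ht, iSup_fwd_secant_le_bwd_secant hg hτ⟩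

/-- The supremum is non-negative as soon as ONE forward quotient is (e.g. `g t ≤ g 0` for some `t > 0`). -/
theorem iSup_fwd_secant_nonneg_of (hg : ConvexOn ℝ univ g) {t : ℝ} (ht : 0 < t) (hgt : g t ≤ g 0) :
    0 ≤ ⨆ s : {s : ℝ // 0 < s}, (g 0 - g (s : ℝ)) / (s : ℝ) :=
  (div_nonneg (sub_nonneg.mpr hgt) ht.le).trans (fwd_secant_le_iSup hg ht)

/-- **The supremum is the one-sided derivative.** Under convexity the forward quotients are
non-increasing in `t`, hence CONVERGE as `t → 0⁺`, and the limit is their supremum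
(`= heatDissipation` in the tree instance below): `D(v) = lim_{t→0⁺} (g 0 − g t)/t`. -/
theorem tendsto_fwd_secant_iSup (hg : ConvexOn ℝ univ g) :
    Filter.Tendsto (fun t : ℝ => (g 0 - g t) / t) (nhdsWithin 0 (Ioi 0))
      (nhds (⨆ s : {s : ℝ // 0 < s}, (g 0 - g (s : ℝ)) / (s : ℝ))) := by
  have hanti : Antitone (fun s : {s : ℝ // 0 < s} => (g 0 - g (s : ℝ)) / (s : ℝ)) := by
    intro s t hst
    exact fwd_secant_antitone hg s.2 hst
  have h := tendsto_atBot_ciSup hanti (bddAbove_fwd_secant hg)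
  exact (tendsto_comp_coe_Ioi_atBot (a := (0 : ℝ)) (f := fun t : ℝ => (g 0 - g t) / t)).mp h

/-- … and every backward quotient caps that limit (the form an upper-bound certificate uses). -/
theorem limit_fwd_secant_le_bwd_secant (hg : ConvexOn ℝ univ g) {L : ℝ}
    (hL : Filter.Tendsto (fun t : ℝ => (g 0 - g t) / t) (nhdsWithin 0 (Ioi 0)) (nhds L))
    {τ : ℝ} (hτ : 0 < τ) : L ≤ (g (-τ) - g 0) / τ := by
  have huniq := tendsto_nhds_unique hL (tendsto_fwd_secant_iSup hg)
  rw [huniq]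
  exact iSup_fwd_secant_le_bwd_secant hg hτ

end ConvexSecant

/-! ### The tree's `heatDissipation` -/

section Tree

open Summit.NavierStokesRegularity.FunctionalMining
open Literature.Analysis.FunctionSpaces Literature.Analysis.FluidPDE

variable {d : Type*} [Fintype d]

/-- `heatDissipation Φ v` IS the supremum of the forward secant quotients of
`g(t) := Φ (v + t • Δv)` (definitional unfolding, recorded for the prover). -/
theorem heatDissipation_eq_iSup (Φ : (UnitAddTorus d → EuclideanSpace ℝ d) → ℝ)
    (v : UnitAddTorus d → EuclideanSpace ℝ d) :
    heatDissipation Φ v =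
      ⨆ s : {s : ℝ // 0 < s}, ((fun t : ℝ => Φ (v + t • Torus.laplacian v)) 0 -
        (fun t : ℝ => Φ (v + t • Torus.laplacian v)) (s : ℝ)) / (s : ℝ) := by
  simp only [heatDissipation, zero_smul, add_zero]

/-- LOWER secant bound: for a functional convex along the heat line, every forward difference
quotient at an explicit `t > 0` is a lower bound for `heatDissipation Φ v`. -/
theorem fwd_secant_le_heatDissipation {Φ : (UnitAddTorus d → EuclideanSpace ℝ d) → ℝ}
    {v : UnitAddTorus d → EuclideanSpace ℝ d}
    (hconv : ConvexOn ℝ univ (fun t : ℝ => Φ (v + t • Torus.laplacian v))) {t : ℝ} (ht : 0 < t) :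
    (Φ v - Φ (v + t • Torus.laplacian v)) / t ≤ heatDissipation Φ v := by
  have h := fwd_secant_le_iSup hconv ht
  simp only [zero_smul, add_zero] at h
  rw [heatDissipation_eq_iSup]
  simpa only [zero_smul, add_zero] using h

/-- UPPER secant bound: for a functional convex along the heat line, every backward difference
quotient at an explicit `τ > 0` is an upper bound for `heatDissipation Φ v`. -/
theorem heatDissipation_le_bwd_secant {Φ : (UnitAddTorus d → EuclideanSpace ℝ d) → ℝ}
    {v : UnitAddTorus d → EuclideanSpace ℝ d}
    (hconv : ConvexOn ℝ univ (fun t : ℝ => Φ (v + t • Torus.laplacian v))) {τ : ℝ} (hτ : 0 < τ) :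
    heatDissipation Φ v ≤ (Φ (v - τ • Torus.laplacian v) - Φ v) / τ := by
  have h := iSup_fwd_secant_le_bwd_secant hconv hτ
  simp only [zero_smul, add_zero, neg_smul] at h
  rw [heatDissipation_eq_iSup]
  simpa only [zero_smul, add_zero, sub_eq_add_neg] using h

/-- Monotonicity in the step: a smaller forward step gives a larger (better) lower bound. -/
theorem fwd_secant_heat_antitone {Φ : (UnitAddTorus d → EuclideanSpace ℝ d) → ℝ}
    {v : UnitAddTorus d → EuclideanSpace ℝ d}
    (hconv : ConvexOn ℝ univ (fun t : ℝ => Φ (v + t • Torus.laplacian v))) {s t : ℝ} (hs : 0 < s)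
    (hst : s ≤ t) :
    (Φ v - Φ (v + t • Torus.laplacian v)) / t ≤ (Φ v - Φ (v + s • Torus.laplacian v)) / s := by
  have h := fwd_secant_antitone hconv hs hst
  simpa only [zero_smul, add_zero] using h

/-- **`heatDissipation` is the one-sided derivative along the affine heat line**: for a functional
convex along `t ↦ v + tΔv`, `(Φ v − Φ (v + tΔv))/t → heatDissipation Φ v` as `t → 0⁺`
(the supremum in the tree's definition is attained as a limit, not merely bounded). -/
theorem tendsto_fwd_secant_heatDissipation {Φ : (UnitAddTorus d → EuclideanSpace ℝ d) → ℝ}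
    {v : UnitAddTorus d → EuclideanSpace ℝ d}
    (hconv : ConvexOn ℝ univ (fun t : ℝ => Φ (v + t • Torus.laplacian v))) :
    Filter.Tendsto (fun t : ℝ => (Φ v - Φ (v + t • Torus.laplacian v)) / t) (nhdsWithin 0 (Ioi 0))
      (nhds (heatDissipation Φ v)) := by
  have h := tendsto_fwd_secant_iSup hconv
  rw [heatDissipation_eq_iSup]
  simpa only [zero_smul, add_zero] using h

variable [DecidableEq d]

/-- **Certificate interface.** ONE admissible field caps every coercivity rate from above by a
backward secant quotient: if `Φ` is heat-coercive at rate `c` on `T³`, then for every smooth,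
divergence-free, zero-mean `v` with `Φ v > 0` along whose heat line `Φ` is convex, and every `τ > 0`,
`c ≤ (Φ (v − τΔv) − Φ v) / (τ Φ v)`. (Two evaluations of `Φ`; no eigenvector, no derivative.) -/
theorem HeatCoercive.rate_le_bwd_secant_quotient {Φ : (UnitAddTorus d → EuclideanSpace ℝ d) → ℝ}
    {c : ℝ} (h : HeatCoercive Φ c) (hd : Fintype.card d = 3)
    {v : UnitAddTorus d → EuclideanSpace ℝ d} (hv : Torus.IsSmooth v) (hdiv : Torus.IsDivFree v)
    (hmean : Torus.HasZeroMean v) (hpos : 0 < Φ v)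
    (hconv : ConvexOn ℝ univ (fun t : ℝ => Φ (v + t • Torus.laplacian v))) {τ : ℝ} (hτ : 0 < τ) :
    c ≤ (Φ (v - τ • Torus.laplacian v) - Φ v) / (τ * Φ v) := by
  have h1 : c * Φ v ≤ heatDissipation Φ v := h hd v hv hdiv hmean
  have h2 := heatDissipation_le_bwd_secant hconv hτ
  rw [le_div_iff₀ (mul_pos hτ hpos)]
  have h3 : c * Φ v ≤ (Φ (v - τ • Torus.laplacian v) - Φ v) / τ := h1.trans h2
  have h4 := (le_div_iff₀ hτ).mp h3
  nlinarith [h4]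

/-- Contrapositive reading used by an upper-bound certificate: a certified number `U` with
`(Φ (v − τΔv) − Φ v) / (τ Φ v) ≤ U` on one admissible field excludes every rate `c > U`. -/
theorem not_heatCoercive_of_bwd_secant_lt {Φ : (UnitAddTorus d → EuclideanSpace ℝ d) → ℝ}
    {c U : ℝ} (hd : Fintype.card d = 3)
    {v : UnitAddTorus d → EuclideanSpace ℝ d} (hv : Torus.IsSmooth v) (hdiv : Torus.IsDivFree v)
    (hmean : Torus.HasZeroMean v) (hpos : 0 < Φ v)
    (hconv : ConvexOn ℝ univ (fun t : ℝ => Φ (v + t • Torus.laplacian v))) {τ : ℝ} (hτ : 0 < τ)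
    (hU : (Φ (v - τ • Torus.laplacian v) - Φ v) / (τ * Φ v) ≤ U) (hcU : U < c) :
    ¬ HeatCoercive Φ c := fun h =>
  absurd ((HeatCoercive.rate_le_bwd_secant_quotient h hd hv hdiv hmean hpos hconv hτ).trans hU)
    (not_le.mpr hcU)

/-- The same interface for the `λ₁`-core row `TopEigHeatCoercive q c` of the tree. -/
theorem TopEigHeatCoercive.rate_le_bwd_secant_quotient {q c : ℝ}
    (h : TopEigHeatCoercive (d := d) q c) (hd : Fintype.card d = 3)
    {v : UnitAddTorus d → EuclideanSpace ℝ d} (hv : Torus.IsSmooth v) (hdiv : Torus.IsDivFree v)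
    (hmean : Torus.HasZeroMean v) (hpos : 0 < torusTopEigMoment q v)
    (hconv : ConvexOn ℝ univ (fun t : ℝ => torusTopEigMoment q (v + t • Torus.laplacian v)))
    {τ : ℝ} (hτ : 0 < τ) :
    c ≤ (torusTopEigMoment q (v - τ • Torus.laplacian v) - torusTopEigMoment q v) /
      (τ * torusTopEigMoment q v) :=
  HeatCoercive.rate_le_bwd_secant_quotient h hd hv hdiv hmean hpos hconv hτ

end Tree

end Summit.NavierStokesRegularity.FunctionalMining.SecantA
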